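import Literature.MathematicalPhysics.QuantumFieldTheory.BalabanImbrieJaffe1984to88.BIJ88HoleProduct5154

/-!
# `BalabanImbrieJaffe1984to88.BIJ88Compatibility5154` — T. Bałaban, J. Imbrie, A. Jaffe, *Effective action and cluster properties of the
abelian Higgs model*, Commun. Math. Phys. **114** (1988) 257–315 [BalabanImbrieJaffe1988], p. 314 [PDF 58], the sentence under **(5.15.4)**:
*"g_{k+1}(X_{ω′}) = Σ_{S₄, σ̃₁, Λ̃₉^{(k)}∩X_{ω′}, {X_α}, {X_{r′}}, S₆ compatible with X_{ω′}} × ∫dφ^{(k)}|_{Λ₁₀^{(k)c}∩X_{ω′}} (…) (5.15.4)  Compatibility means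
that the summations run over sets associated only with X_{ω′} and that the sets would have given us X_{ω′} in the course of our constructions"*,
and p. 313: *"Let {X_{ω′}} be the components of Λ^{(k)c}_{13}, and let X_{ω′} also specify Λ^{(k)c}_α ∩ X_{ω′} and a collection {X_ω} of sets from the
previous step. We exhibit the factorization of most of the terms in ρ_{k+1}(v, ψ) by writing … ρ′_{k+1} = χ_{k+1,Λ₀^{(k)′}} Π_{ω′} g_{k+1}(X_{ω′}) …"* —
**THE FACTORIZATION OF THE SUM OVER COMPATIBLE DATA INTO THE PRODUCT `Π_{ω′} g_{k+1}(X_{ω′})`, PROVED FROM WHAT "COMPATIBLE" SAYS.**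

statement-level skeleton of published theorems with citation tags; proofs where landed; nothing here is a claim about the Yang–Mills mass gap

WHAT THE TREE HAD.  p34's `BIJ88HoleProduct5154.ae_eq_hole_product` / `result41_hole_product` prove the RESULT pp. 313–314 with the hole functionals
as a PRODUCT of functions of the previous fields, `ρ̃(v, ψ) = Σ_ω ∫_{Π𝒟u^{(j)}} G_ω·Π_{ω′}(∫dφ^{(k)}|_{ext∩X_{ω′}} y_{ω,ω′})` a.e., GIVEN the pointwise
hypothesis `hprod`: for each hole family `ω = {X_{ω′}}` the sum over its compatible data `c ∈ fam ω` of the integrands IS a global factor times a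
product over the components of block functions — *"the combinatorial content of (5.15.4)"* (its header), displayed, not derived.  Owner r16's
NOT-done list of row C2.Claim@313 (v2.122): *"the Π_{ω′}g_{k+1}(X_{ω′}) factorization of the hole sum from locality/«compatibility» (beyond
`BIJ88HoleProduct5154`'s displayed pointwise product structure hprod)"*.

WHAT IS PROVED HERE (theorems only; 0 `sorry`; no definition, no `Prop`-valued fact; standard axioms).  `hprod` DERIVED from the two things the
printed sentence says: (α) *"the summations run over sets associated only with X_{ω′}"* — the compatible data of a hole family are parametrized by an
INDEPENDENT choice per component, `π_ω : {c ∈ fam ω} ≃ Π_{ω′} C_{ω,ω′}` (a product parametrization); (β) every summand is LOCAL — the integrand of the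
datum `c` is a global factor `G_ω` (χ, `Π_{σ′}F`, `ΠZ`, the exponential of p. 313: functions of `{u^{(j)}}`, `v`, `ψ` only) times the product over the
components `ω′` of a factor `z_{ω,ω′}(c_{ω′})` depending only on the choice for that component and on the exterior scalar variables IN `X_{ω′}`.
* §1 **`sum_eq_mul_prod_sum`** — the algebra: under (α)/(β), `Σ_{c ∈ fam} Y_c = G · Π_κ Σ_{d ∈ C_κ} z_κ(d)` (reindexing along `π`, then Mathlib's
  `Fintype.prod_sum` *"a product of sums is the sum over choice functions of the products"* read backwards) — any commutative semiring.
* §2 **`hprod_of_compatible`** — p34's hypothesis `hprod` in its literal form, with the block functions `y_{ω,ω′} := Σ_{d ∈ C_{ω,ω′}} z_{ω,ω′}(d)`: *"g_{k+1}(X_{ω′})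
  = Σ_{… compatible with X_{ω′}} (…)"* — each hole functional is ITSELF a sum over the data associated with its own component;
  **`ae_eq_hole_product_of_compatible`** — p34's `ae_eq_hole_product` with `hprod` DISCHARGED: from the RESULT as a double sum (the literal output
  of `BIJ88Eq596FibreIntegral.result41_ae_eq`, hypothesis `hR`), the coincidence `hD` of the interior sets on a hole family, (α), (β) and integrability:
  `ρ̃(v, ψ) = Σ_ω ∫_{Π_{j≤k}𝒟u^{(j)}} G_ω · Π_{ω′} ∫dφ^{(k)}|_{ext∩X_{ω′}} Σ_{d} z_{ω,ω′}(d)` a.e. over r18's `prevMeasure P (k+1)`.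
* §3 **`holeFunctional_eq_sum_integral`** — with integrable pieces the hole functional is the printed *sum of integrals*: `∫dφ^{(k)}|_{ext∩X_{ω′}} Σ_d z(d)
  = Σ_d ∫dφ^{(k)}|_{ext∩X_{ω′}} z(d)` = the shape of (5.15.4) `g_{k+1}(X_{ω′}) = Σ_{compatible} ∫dφ^{(k)}|_{Λ₁₀^{(k)c}∩X_{ω′}} (…)`; and
  **`ae_eq_hole_product_printed`** — §2 with every hole functional in that shape.
HONEST SCOPE.  (α) and (β) are DISPLAYED hypotheses: that the expansion data of Sects. 5.11–5.14 (S₄, σ̃₁, Λ̃₉∩X_{ω′}, {X_α}, {X_{r′}}, S₆) ARE chosen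
independently per component of Λ^{(k)c}_{13} with local summands is the content of *"the sets would have given us X_{ω′} in the course of our
constructions"* — a property of those constructions (rows C2.Txt@300, C2.Eq5.13.x–5.14.x), not re-derived here; no bound (*"a certain «density» of terms
leading to convergence factors"* is the deferred estimate, row C2.Txt@314); the value type of the hole functionals is p34's (`ℂ`; cf. HOME/GAPS.md
G-C2-26 on r18's real `Term41.g`).  Nothing of B1–B16; NOT summit progress; NOT continuum; NOT Clay.
CITATION HEADER (lean-in-tree rule).  Part of the lit-balaban TYPED SKELETON (HOME `run/shared/lean/pub/lit-balaban/`), PHASE-2 proof seat p31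
gen 14 (unit `lit-balaban-p31-g14`; TAKING line HOME/STATUS.md 2026-08-22, free-target protocol G.5-34(d), own lane = the RESULT pp. 313–314 line,
companion of this gen's `BIJ88Form41Succ`).  Rows served: **`C2.Claim@313`** member (owner r16: NOT-done item *"Π_{ω′}g_{k+1} factorization from
locality beyond hprod"*), **`C2.Eq5.15.4`**-material as recorded by r16 under Claim@313.  PDF held: `paper:balaban1988-cmp114-bij-abelian-higgs-effective-action`
(journal page = PDF page + 256); p. 314 [PDF 58] read this session as an image (`HOME/lit-balaban-r16/renders/cmp114/original-p058-x2.png`).  Imports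
p34's `BIJ88HoleProduct5154` only (Literature + Mathlib); sub-namespace `…BIJ88Compatibility5154`; nothing re-declared, nothing restated.
-/

namespace Literature.MathematicalPhysics.QuantumFieldTheory.BalabanImbrieJaffe1984to88.BIJ88Compatibility5154

open Literature.MathematicalPhysics.QuantumFieldTheory.Balaban1983to89
open BIJ88Sect3Statements (U1)
open BIJ85Sect1Model (HiggsField)
open BIJ88InductiveForm41 (Prev prevMeasure)
open BIJ88Eq5128Split (Cfg Interior)
open BIJ88FinalForm313 (cfg41)
open BIJ88HoleProduct5154 (ae_eq_hole_product)
open scoped BigOperators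
open _root_.MeasureTheory Function

noncomputable section

/-! ## §1 The algebra of "compatible": a sum over product-parametrized local data is a product of sums -/

section Algebra

variable {A K R : Type*} [CommSemiring R] [Fintype K] [DecidableEq K]

/-- **«Compatibility means that the summations run over sets associated only with X_{ω′}» ⟹ FACTORIZATION.**  If the compatible data `fam` of a hole
family are parametrized by an independent choice per component (`π : {c ∈ fam} ≃ Π_κ C_κ`) and every summand is a global factor `G` times a product over
the components of factors depending only on the component's choice (`hloc`), then the sum over the compatible data is `G` times the PRODUCT over the
components of the per-component sums: `Σ_{c∈fam} Y_c = G · Π_κ Σ_{d} z_κ(d)` (Mathlib's `Fintype.prod_sum`, reindexed along `π`).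
[cite: BalabanImbrieJaffe1988, (5.15.4) p.314] -/
theorem sum_eq_mul_prod_sum (fam : Finset A) (C : K → Type*) [∀ κ, Fintype (C κ)] (π : {c // c ∈ fam} ≃ ((κ : K) → C κ))
    (G : R) (Y : A → R) (z : (κ : K) → C κ → R) (hloc : ∀ c : {c // c ∈ fam}, Y c = G * ∏ κ, z κ (π c κ)) :
    ∑ c ∈ fam, Y c = G * ∏ κ, ∑ d, z κ d := by
  rw [Fintype.prod_sum, Finset.mul_sum, ← Finset.sum_coe_sort fam, ← π.sum_comp]
  exact Finset.sum_congr rfl fun c _ => hloc c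

/-- The same with the global factor absent (`G = 1`): `Σ_{c∈fam} Π_κ z_κ(c_κ) = Π_κ Σ_d z_κ(d)`. [cite: BalabanImbrieJaffe1988, (5.15.4) p.314] -/
theorem sum_prod_eq_prod_sum (fam : Finset A) (C : K → Type*) [∀ κ, Fintype (C κ)] (π : {c // c ∈ fam} ≃ ((κ : K) → C κ))
    (Y : A → R) (z : (κ : K) → C κ → R) (hloc : ∀ c : {c // c ∈ fam}, Y c = ∏ κ, z κ (π c κ)) :
    ∑ c ∈ fam, Y c = ∏ κ, ∑ d, z κ d := by
  have h := sum_eq_mul_prod_sum fam C π 1 Y z (fun c => by rw [one_mul]; exact hloc c)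
  rwa [one_mul] at h

end Algebra

/-! ## §2 p34's `hprod` discharged; the RESULT with factorized hole functionals -/

section Holes

variable {P : Params} {k : ℕ} {Ω ι' : Type*}

/-- **p34's pointwise product hypothesis `hprod` FROM «compatible»**: for every hole family `ω`, if its compatible data are a choice per component
(`π ω`) and the integrand of the datum `c` at the configuration `({u^{(j)}}, φ^{(k)}|_{ext})` is the global factor `G_ω` times the product over the
components `ω′` of `z_{ω,ω′}(c_{ω′})` read on the exterior scalar variables in `X_{ω′}` (`hloc`), then `Σ_{c∈fam ω} Y_c = G_ω · Π_{ω′} y_{ω,ω′}` with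
**`y_{ω,ω′} := Σ_{d ∈ C_{ω,ω′}} z_{ω,ω′}(d)`** — each hole functional is itself *"Σ_{… compatible with X_{ω′}} (…)"*, a sum over the data of its own component.
[cite: BalabanImbrieJaffe1988, (5.15.4) p.314] -/
theorem hprod_of_compatible (holes : Finset Ω) (fam : Ω → Finset ι') (DΩ : Ω → Interior P k)
    (KΩ : Ω → Type*) [∀ ω, Fintype (KΩ ω)] [∀ ω, DecidableEq (KΩ ω)]
    (comp : (ω : Ω) → {x : Balaban1983to89.Site P k // x ∉ (DΩ ω).Ix} → KΩ ω)
    (Y : ι' → Cfg P k → GaugeField P (k+1) U1 → HiggsField P (k+1) → ℂ)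
    (G : Ω → Prev P (k+1) → GaugeField P (k+1) U1 → HiggsField P (k+1) → ℂ)
    (C : (ω : Ω) → KΩ ω → Type*) [∀ ω κ, Fintype (C ω κ)]
    (π : (ω : Ω) → {c // c ∈ fam ω} ≃ ((κ : KΩ ω) → C ω κ))
    (z : (ω : Ω) → (κ : KΩ ω) → C ω κ → Prev P (k+1) → ({x // comp ω x = κ} → ℂ) → GaugeField P (k+1) U1 → HiggsField P (k+1) → ℂ)
    (hloc : ∀ ω ∈ holes, ∀ (c : {c // c ∈ fam ω}) (pp : Prev P (k+1)) (e : (DΩ ω).EX) (v : GaugeField P (k+1) U1) (ψ : HiggsField P (k+1)),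
      Y c (cfg41 (DΩ ω) (pp, e)) v ψ = G ω pp v ψ * ∏ κ, z ω κ (π ω c κ) pp (fun j => e j.1) v ψ) :
    ∀ ω ∈ holes, ∀ (pp : Prev P (k+1)) (e : (DΩ ω).EX) (v : GaugeField P (k+1) U1) (ψ : HiggsField P (k+1)),
      ∑ c ∈ fam ω, Y c (cfg41 (DΩ ω) (pp, e)) v ψ =
        G ω pp v ψ * ∏ κ, (∑ d, z ω κ d pp (fun j => e j.1) v ψ) :=
  fun ω hω pp e v ψ =>
    sum_eq_mul_prod_sum (fam ω) (C ω) (π ω) (G ω pp v ψ) (fun c => Y c (cfg41 (DΩ ω) (pp, e)) v ψ)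
      (fun κ d => z ω κ d pp (fun j => e j.1) v ψ) fun c => hloc ω hω c pp e v ψ

variable {ρL : GaugeField P (k+1) U1 → HiggsField P (k+1) → ℂ}

/-- **THE RESULT WITH THE HOLE FUNCTIONALS FACTORIZED, «COMPATIBLE» ⟹ `Π_{ω′} g_{k+1}(X_{ω′})`** — p34's `BIJ88HoleProduct5154.ae_eq_hole_product` with
its displayed hypothesis `hprod` DISCHARGED by `hprod_of_compatible`.  INPUT: the RESULT as the double sum `ρ̃(v, ψ) = Σ_ω Σ_{c∈fam ω} ∫_{Π𝒟u^{(j)} ⊗ dφ^{(k)}|_{ext_c}}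
Y_c(cfg41_c r; v, ψ)` a.e. (the literal output of p34's `BIJ88Eq596FibreIntegral.result41_ae_eq`), the coincidence of the interior sets on each hole family
(`hD`: *"let X_{ω′} also specify Λ^{(k)c}_α ∩ X_{ω′}"*), the product parametrization of the compatible data (`π`) with local summands (`hloc`), integrability.
CONCLUSION, a.e. in `(v, ψ)`: `ρ̃(v, ψ) = Σ_ω ∫_{Π_{j≤k}𝒟u^{(j)}} G_ω({u^{(j)}}; v, ψ) · Π_{ω′} ∫dφ^{(k)}|_{ext∩X_{ω′}} Σ_{d∈C_{ω,ω′}} z_{ω,ω′}(d)({u^{(j)}}, φ^{(k)}|_{ext∩X_{ω′}}; v, ψ)`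
— *"ρ′_{k+1} = χ_{k+1,Λ₀^{(k)′}} Π_{ω′} g_{k+1}(X_{ω′}) …"* over r18's `prevMeasure P (k+1)`. [cite: BalabanImbrieJaffe1988, (5.15.4) p.314] -/
theorem ae_eq_hole_product_of_compatible [DecidableEq Ω] {Y : ι' → Cfg P k → GaugeField P (k+1) U1 → HiggsField P (k+1) → ℂ}
    (D : ι' → Interior P k) (holes : Finset Ω) (fam : Ω → Finset ι')
    (hR : uncurry ρL =ᵐ[(fieldMeasure P (k+1) U1).prod volume]
      uncurry (fun v ψ => ∑ ω ∈ holes, ∑ c ∈ fam ω,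
        ∫ r, Y c (cfg41 (D c) r) v ψ ∂(prevMeasure P (k+1)).prod (volume : Measure (D c).EX)))
    (DΩ : Ω → Interior P k) (hD : ∀ ω ∈ holes, ∀ c ∈ fam ω, D c = DΩ ω)
    (KΩ : Ω → Type*) [∀ ω, Fintype (KΩ ω)] [∀ ω, DecidableEq (KΩ ω)]
    (comp : (ω : Ω) → {x : Balaban1983to89.Site P k // x ∉ (DΩ ω).Ix} → KΩ ω)
    (G : Ω → Prev P (k+1) → GaugeField P (k+1) U1 → HiggsField P (k+1) → ℂ)
    (C : (ω : Ω) → KΩ ω → Type*) [∀ ω κ, Fintype (C ω κ)]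
    (π : (ω : Ω) → {c // c ∈ fam ω} ≃ ((κ : KΩ ω) → C ω κ))
    (z : (ω : Ω) → (κ : KΩ ω) → C ω κ → Prev P (k+1) → ({x // comp ω x = κ} → ℂ) → GaugeField P (k+1) U1 → HiggsField P (k+1) → ℂ)
    (hloc : ∀ ω ∈ holes, ∀ (c : {c // c ∈ fam ω}) (pp : Prev P (k+1)) (e : (DΩ ω).EX) (v : GaugeField P (k+1) U1) (ψ : HiggsField P (k+1)),
      Y c (cfg41 (DΩ ω) (pp, e)) v ψ = G ω pp v ψ * ∏ κ, z ω κ (π ω c κ) pp (fun j => e j.1) v ψ)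
    (hYi : ∀ ω ∈ holes, ∀ c ∈ fam ω, ∀ (v : GaugeField P (k+1) U1) (ψ : HiggsField P (k+1)),
      Integrable (fun r => Y c (cfg41 (DΩ ω) r) v ψ) ((prevMeasure P (k+1)).prod (volume : Measure (DΩ ω).EX))) :
    uncurry ρL =ᵐ[(fieldMeasure P (k+1) U1).prod volume]
      uncurry (fun v ψ => ∑ ω ∈ holes, ∫ pp, (G ω pp v ψ *
        ∏ κ, ∫ w : {x // comp ω x = κ} → ℂ, ∑ d, z ω κ d pp w v ψ) ∂prevMeasure P (k+1)) :=
  ae_eq_hole_product D holes fam hR DΩ hD KΩ comp G (fun ω κ pp w v ψ => ∑ d, z ω κ d pp w v ψ)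
    (hprod_of_compatible holes fam DΩ KΩ comp Y G C π z hloc) hYi

end Holes

/-! ## §3 Each hole functional in the printed shape: a sum of `dφ^{(k)}`-integrals -/

section Printed

variable {P : Params} {k : ℕ} {Ω ι' : Type*}

/-- **«g_{k+1}(X_{ω′}) = Σ_{… compatible with X_{ω′}} × ∫dφ^{(k)}|_{Λ₁₀^{(k)c}∩X_{ω′}} (…)»**: with integrable pieces, the hole functional of a component — the
`dφ^{(k)}|_{ext∩X_{ω′}}`-integral of the sum over its data — is the printed SUM OF INTEGRALS. [cite: BalabanImbrieJaffe1988, (5.15.4) p.314] -/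
theorem holeFunctional_eq_sum_integral {X : Type*} [Fintype X] {Cd : Type*} [Fintype Cd] (z : Cd → (X → ℂ) → ℂ)
    (hzi : ∀ d, Integrable (z d) (volume : Measure (X → ℂ))) :
    ∫ w : X → ℂ, ∑ d, z d w = ∑ d, ∫ w : X → ℂ, z d w :=
  integral_finsetSum _ fun d _ => hzi d

/-- **THE RESULT WITH `Π_{ω′} g_{k+1}(X_{ω′})` AND EVERY `g_{k+1}(X_{ω′})` IN THE PRINTED SHAPE** `Σ_{d} ∫dφ^{(k)}|_{ext∩X_{ω′}} z_{ω,ω′}(d)` — §2 followed by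
`holeFunctional_eq_sum_integral` in every component (pieces integrable in the component's exterior scalar variables, `hzi`).
[cite: BalabanImbrieJaffe1988, (5.15.4) p.314] -/
theorem ae_eq_hole_product_printed [DecidableEq Ω] {ρL : GaugeField P (k+1) U1 → HiggsField P (k+1) → ℂ}
    {Y : ι' → Cfg P k → GaugeField P (k+1) U1 → HiggsField P (k+1) → ℂ}
    (D : ι' → Interior P k) (holes : Finset Ω) (fam : Ω → Finset ι')
    (hR : uncurry ρL =ᵐ[(fieldMeasure P (k+1) U1).prod volume]
      uncurry (fun v ψ => ∑ ω ∈ holes, ∑ c ∈ fam ω,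
        ∫ r, Y c (cfg41 (D c) r) v ψ ∂(prevMeasure P (k+1)).prod (volume : Measure (D c).EX)))
    (DΩ : Ω → Interior P k) (hD : ∀ ω ∈ holes, ∀ c ∈ fam ω, D c = DΩ ω)
    (KΩ : Ω → Type*) [∀ ω, Fintype (KΩ ω)] [∀ ω, DecidableEq (KΩ ω)]
    (comp : (ω : Ω) → {x : Balaban1983to89.Site P k // x ∉ (DΩ ω).Ix} → KΩ ω)
    (G : Ω → Prev P (k+1) → GaugeField P (k+1) U1 → HiggsField P (k+1) → ℂ)
    (C : (ω : Ω) → KΩ ω → Type*) [∀ ω κ, Fintype (C ω κ)]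
    (π : (ω : Ω) → {c // c ∈ fam ω} ≃ ((κ : KΩ ω) → C ω κ))
    (z : (ω : Ω) → (κ : KΩ ω) → C ω κ → Prev P (k+1) → ({x // comp ω x = κ} → ℂ) → GaugeField P (k+1) U1 → HiggsField P (k+1) → ℂ)
    (hloc : ∀ ω ∈ holes, ∀ (c : {c // c ∈ fam ω}) (pp : Prev P (k+1)) (e : (DΩ ω).EX) (v : GaugeField P (k+1) U1) (ψ : HiggsField P (k+1)),
      Y c (cfg41 (DΩ ω) (pp, e)) v ψ = G ω pp v ψ * ∏ κ, z ω κ (π ω c κ) pp (fun j => e j.1) v ψ)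
    (hYi : ∀ ω ∈ holes, ∀ c ∈ fam ω, ∀ (v : GaugeField P (k+1) U1) (ψ : HiggsField P (k+1)),
      Integrable (fun r => Y c (cfg41 (DΩ ω) r) v ψ) ((prevMeasure P (k+1)).prod (volume : Measure (DΩ ω).EX)))
    (hzi : ∀ ω ∈ holes, ∀ (κ : KΩ ω) (d : C ω κ) (pp : Prev P (k+1)) (v : GaugeField P (k+1) U1) (ψ : HiggsField P (k+1)),
      Integrable (fun w : {x // comp ω x = κ} → ℂ => z ω κ d pp w v ψ)) :
    uncurry ρL =ᵐ[(fieldMeasure P (k+1) U1).prod volume]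
      uncurry (fun v ψ => ∑ ω ∈ holes, ∫ pp, (G ω pp v ψ *
        ∏ κ, ∑ d, ∫ w : {x // comp ω x = κ} → ℂ, z ω κ d pp w v ψ) ∂prevMeasure P (k+1)) := by
  have h := ae_eq_hole_product_of_compatible D holes fam hR DΩ hD KΩ comp G C π z hloc hYi
  refine h.trans (Filter.EventuallyEq.of_eq ?_)
  funext q
  simp only [uncurry]
  refine Finset.sum_congr rfl fun ω hω => integral_congr_ae (ae_of_all _ fun pp => ?_)
  refine congrArg (G ω pp q.1 q.2 * ·) (Finset.prod_congr rfl fun κ _ => ?_)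
  exact holeFunctional_eq_sum_integral (fun d w => z ω κ d pp w q.1 q.2) fun d => hzi ω hω κ d pp q.1 q.2

end Printed

end

end Literature.MathematicalPhysics.QuantumFieldTheory.BalabanImbrieJaffe1984to88.BIJ88Compatibility5154
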